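import Summits.Ventures.PercRepro.RankLevelSetRuleQCellOne
import Summits.Ventures.PercRepro.RankLevelSetRuleQCellFourRow

/-!
# PercRepro — THE EXACT FORM OF `R̂ − Φ` IN THE UNTRUNCATED REGIME `q − #P ≥ k − 1` (p4, gen 22; C-044; paper
proofs/P4-CELL-THREE.md §10)

For a member slice with `u = q − m ≥ k − 1` every `m̂(q, m; a, i)`, `i ≤ k − 1`, is the plain binomial `C(q+i+a, i+a)`
(`rhat_untrunc_eq`), so with `A(J) = 1/C(q+J, J)` and `n = q + k − m`, `R̂ = Σ_{0<i<k} Σ_{a≤m} C(n,i)C(m,a)·A(i+a)`.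
Grouping by the diagonal `J = i + a` (`sum_Ioo_range_fiber`) and Vandermonde on every diagonal `J ≤ k − 1`
(`vandermonde_fiber`: `Σ_{0<i≤J} C(n,i)C(m,J−i) = C(n+m, J) − C(m, J) = C(q+k, J) − C(m, J)`) cancels those diagonals against
`Φ(q+k, q) = Σ_{0<J<k} C(q+k, J)·A(J)` (`phiK_eq_sum_Ioo`) up to the `i = 0` terms:

  **`rhat_sub_phiK_eq`**: `R̂(q,k,m) − Φ(q+k,q) = Σ_{J=k}^{k+m−1} A(J)·N_J − Σ_{J=1}^{k−1} C(m,J)·A(J)`,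
  `N_J = Σ_{0<i<k, i≤J, J−i≤m} C(n,i)·C(m,J−i)`,

and `rhat_ge_phiK_iff_untrunc` is the equivalent criterion for (R̂) on the whole untruncated regime: the mass of `R̂` on its
diagonals `J ≥ k` must pay the `i = 0` row `Σ_{J<k} C(m,J)/C(q+J,J)`.  This is the form in which (R̂) is numerically true for
every `k` on `u ≥ k − 1` (night-1 g16, INBOX 13040: `k ≤ 14`, `q ≤ 90`, tight only at `m = 2` — the slice proved in
RankLevelSetRuleQFlatTwo, where the identity has the three terms `2C(n,K+1)A(K+2) + C(n,K)A(K+2) + C(n,K+1)A(K+3)`), while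
on the truncated slices `u ≤ k − 3` it fails (RankLevelSetRuleQCellFiveWitness).  Axioms: standard.
-/

namespace PercRepro

open Finset

/-- Re-indexing a double sum over `(i, a)`, `0 < i < k`, `a ≤ m`, by the diagonal `J = i + a`. -/
lemma sum_Ioo_range_fiber (k m : ℕ) (f : ℕ → ℕ → ℚ) (A : ℕ → ℚ) :
    ∑ i ∈ Ioo 0 k, ∑ a ∈ range (m + 1), f i a * A (i + a)
      = ∑ J ∈ range (k + m), A J * ∑ i ∈ Ioo 0 k, (if i ≤ J ∧ J - i ≤ m then f i (J - i) else 0) := by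
  simp_rw [Finset.mul_sum]
  symm
  rw [Finset.sum_comm]
  refine Finset.sum_congr rfl (fun i hi => ?_)
  rw [Finset.mem_Ioo] at hi
  have hsub : Finset.Ico i (i + m + 1) ⊆ range (k + m) := by
    intro J hJ
    rw [Finset.mem_Ico] at hJ
    rw [Finset.mem_range]
    omega
  rw [← Finset.sum_subset hsub (fun J _ hJ => ?_)]
  · rw [Finset.sum_Ico_eq_sum_range, show i + m + 1 - i = m + 1 by omega]
    refine Finset.sum_congr rfl (fun a ha => ?_)
    rw [Finset.mem_range] at ha
    rw [if_pos ⟨by omega, by omega⟩, show i + a - i = a by omega, mul_comm]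
  · rw [Finset.mem_Ico] at hJ
    rw [if_neg (fun h => hJ ⟨h.1, by omega⟩), mul_zero]


/-- Vandermonde on one diagonal `J ≤ k − 1` of the re-indexed sum (in `ℕ`):
`Σ_{0 < i < k} [i ≤ J ∧ J − i ≤ m]·C(n, i)·C(m, J − i) + C(m, J) = C(n + m, J)`. -/
lemma vandermonde_fiber (n m k J : ℕ) (hJk : J < k) :
    (∑ i ∈ Ioo 0 k, (if i ≤ J ∧ J - i ≤ m then n.choose i * m.choose (J - i) else 0)) + m.choose J
      = (n + m).choose J := by
  have h1 : ∀ i ∈ Ioo 0 k, (if i ≤ J ∧ J - i ≤ m then n.choose i * m.choose (J - i) else 0)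
      = if i ≤ J then n.choose i * m.choose (J - i) else 0 := by
    intro i _
    by_cases hi : i ≤ J
    · by_cases hm : J - i ≤ m
      · rw [if_pos ⟨hi, hm⟩, if_pos hi]
      · rw [if_neg (fun h => hm h.2), if_pos hi, Nat.choose_eq_zero_of_lt (show m < J - i by omega), mul_zero]
    · rw [if_neg (fun h => hi h.1), if_neg hi]
  rw [Finset.sum_congr rfl h1, ← Finset.sum_filter]
  have h2 : (Ioo 0 k).filter (fun i => i ≤ J) = Ico 1 (J + 1) := by
    ext i
    simp only [Finset.mem_filter, Finset.mem_Ioo, Finset.mem_Ico]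
    omega
  rw [h2, Finset.sum_Ico_eq_sum_range, show J + 1 - 1 = J by omega]
  have h3 : (n + m).choose J = ∑ i ∈ range (J + 1), n.choose i * m.choose (J - i) := by
    rw [Nat.add_choose_eq, Finset.Nat.sum_antidiagonal_eq_sum_range_succ_mk]
  rw [h3, Finset.sum_range_succ', Nat.choose_zero_right, one_mul, Nat.sub_zero]
  congr 1
  refine Finset.sum_congr rfl (fun i _ => ?_)
  rw [add_comm 1 i]


/-- `R̂(q, k, m)` in the UNTRUNCATED regime `k − 1 ≤ q − m`: every `m̂(q, m; a, i)`, `i ≤ k − 1`, is the binomial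
`C(q + i + a, i + a)`. -/
lemma rhat_untrunc_eq (q k m : ℕ) (hu : k - 1 ≤ q - m) :
    rhat q k m = ∑ i ∈ Ioo 0 k, ∑ a ∈ range (m + 1),
      ((q + k - m).choose i : ℚ) * (m.choose a : ℚ) * (1 / ((q + (i + a)).choose (i + a) : ℚ)) := by
  unfold rhat
  refine Finset.sum_congr rfl (fun i hi => Finset.sum_congr rfl (fun a _ => ?_))
  rw [Finset.mem_Ioo] at hi
  have h : mhat q m a i = (q + (i + a)).choose (i + a) := by
    rw [mhat_eq, show min i (q - m) = i by omega, sum_choose_mul_choose_add (q + a) a i,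
      show q + a + i = q + (i + a) by ring, add_comm a i]
  rw [h]
  push_cast
  ring

/-- `Φ(q+k, q) = Σ_{0 < J < k} C(q+k, J)·A(J)`, `A(J) = 1/C(q+J, J)`. -/
lemma phiK_eq_sum_Ioo (q k : ℕ) (hk : 1 ≤ k) :
    phiK (q + k) q = ∑ J ∈ Ioo 0 k, ((q + k).choose J : ℚ) * (1 / ((q + J).choose J : ℚ)) := by
  rw [phiK_eq_sum_range q k hk, sum_Ioo_nat, show k - (0 + 1) = k - 1 by omega]
  refine Finset.sum_congr rfl (fun u _ => ?_)
  rw [show 0 + 1 + u = u + 1 by ring, show q + u + 1 = q + (u + 1) by ring, Nat.choose_symm_add, mul_one_div]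

/-- **THE EXACT FORM OF `R̂ − Φ` IN THE UNTRUNCATED REGIME** `k − 1 ≤ q − m` (`A(J) = 1/C(q+J, J)`, `n = q + k − m`):
`R̂(q,k,m) − Φ(q+k,q) = Σ_{J=k}^{k+m−1} A(J)·N_J − Σ_{J=1}^{k−1} C(m, J)·A(J)` with
`N_J = Σ_{0 < i < k, i ≤ J, J − i ≤ m} C(n, i)·C(m, J − i)` — every diagonal `J ≤ k − 1` of `R̂` cancels against `Φ`
by Vandermonde up to the `i = 0` term `C(m, J)`, and what is left of `R̂` are its diagonals `J ≥ k`. -/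
theorem rhat_sub_phiK_eq (q k m : ℕ) (hk : 1 ≤ k) (hu : k - 1 ≤ q - m) (hm : m ≤ q) :
    rhat q k m - phiK (q + k) q
      = ∑ J ∈ Ico k (k + m), (1 / ((q + J).choose J : ℚ))
          * ∑ i ∈ Ioo 0 k, (if i ≤ J ∧ J - i ≤ m then ((q + k - m).choose i : ℚ) * (m.choose (J - i) : ℚ) else 0)
        - ∑ J ∈ Ioo 0 k, (m.choose J : ℚ) * (1 / ((q + J).choose J : ℚ)) := by
  rw [rhat_untrunc_eq q k m hu, phiK_eq_sum_Ioo q k hk,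
    sum_Ioo_range_fiber k m (fun i a => ((q + k - m).choose i : ℚ) * (m.choose a : ℚ))
      (fun J => 1 / ((q + J).choose J : ℚ)),
    ← Finset.sum_range_add_sum_Ico _ (show k ≤ k + m by omega), Finset.range_eq_Ico,
    Finset.sum_eq_sum_Ico_succ_bot (show 0 < k by omega)]
  have hIco : Ico (0 + 1) k = Ioo 0 k := by
    ext i
    simp only [Finset.mem_Ico, Finset.mem_Ioo]
    omega
  rw [hIco]
  have hN0 : (∑ i ∈ Ioo 0 k, (if i ≤ 0 ∧ 0 - i ≤ m then ((q + k - m).choose i : ℚ) * (m.choose (0 - i) : ℚ) else 0))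
      = 0 := by
    refine Finset.sum_eq_zero (fun i hi => ?_)
    rw [Finset.mem_Ioo] at hi
    rw [if_neg (fun h => by omega)]
  have hN : ∀ J ∈ Ioo 0 k,
      (∑ i ∈ Ioo 0 k, (if i ≤ J ∧ J - i ≤ m then ((q + k - m).choose i : ℚ) * (m.choose (J - i) : ℚ) else 0))
        = ((q + k).choose J : ℚ) - (m.choose J : ℚ) := by
    intro J hJ
    rw [Finset.mem_Ioo] at hJ
    have h := vandermonde_fiber (q + k - m) m k J hJ.2
    rw [show q + k - m + m = q + k by omega] at h
    have h' := congrArg (Nat.cast (R := ℚ)) h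
    push_cast at h'
    linarith
  rw [hN0, mul_zero, zero_add, Finset.sum_congr rfl (fun J hJ => by rw [hN J hJ])]
  simp only [mul_sub, Finset.sum_sub_distrib]
  have e1 : ∑ J ∈ Ioo 0 k, (1 / ((q + J).choose J : ℚ)) * ((q + k).choose J : ℚ)
      = ∑ J ∈ Ioo 0 k, ((q + k).choose J : ℚ) * (1 / ((q + J).choose J : ℚ)) :=
    Finset.sum_congr rfl (fun _ _ => mul_comm _ _)
  have e2 : ∑ J ∈ Ioo 0 k, (1 / ((q + J).choose J : ℚ)) * (m.choose J : ℚ)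
      = ∑ J ∈ Ioo 0 k, (m.choose J : ℚ) * (1 / ((q + J).choose J : ℚ)) :=
    Finset.sum_congr rfl (fun _ _ => mul_comm _ _)
  rw [e1, e2]
  ring


/-- **THE CRITERION FOR (R̂) ON THE UNTRUNCATED REGIME**: `Φ(q+k, q) ≤ R̂(q, k, m)` iff the `i = 0` row
`Σ_{0<J<k} C(m, J)/C(q+J, J)` is paid by the diagonals `J ≥ k` of `R̂`. -/
theorem rhat_ge_phiK_iff_untrunc (q k m : ℕ) (hk : 1 ≤ k) (hu : k - 1 ≤ q - m) (hm : m ≤ q) :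
    phiK (q + k) q ≤ rhat q k m ↔
      ∑ J ∈ Ioo 0 k, (m.choose J : ℚ) * (1 / ((q + J).choose J : ℚ))
        ≤ ∑ J ∈ Ico k (k + m), (1 / ((q + J).choose J : ℚ))
          * ∑ i ∈ Ioo 0 k, (if i ≤ J ∧ J - i ≤ m then ((q + k - m).choose i : ℚ) * (m.choose (J - i) : ℚ) else 0) := by
  rw [← sub_nonneg, rhat_sub_phiK_eq q k m hk hu hm, sub_nonneg]

end PercRepro
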